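import Literature.AlgebraicGeometry.ModuliOfAbelianVarieties.SiegelFineModuliSchemeOfCores   -- ★ p796022 F-12-of-cores ED. 3 `exists_threshold_siegelFineModuliScheme_of_cores''` ([MumfordFogartyKirwan1994] Thm. 7.9 «for `n` large»; F0P1a-p01 (g2), Q7)
import Literature.AlgebraicGeometry.ModuliOfAbelianVarieties.SiegelFineModuliSchemeLevelDescent   -- ★ p766238 F-10 LEVEL DESCENT `lan2013_siegelFineModuliScheme_of_large_levels` (remark after Thm. 7.9, Lemma 7.11)
import Literature.AlgebraicGeometry.AbelianSchemes.LinearRigidificationStepTwo   -- ★ p796432 F23 CORE II `AbelianSchemeOver.exists_groupLawLocus_of_projective` ([MumfordFogartyKirwan1994] Prop. 6.16 ∕ Thm. 6.14 step (II); F0P1a-p02 (g2))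
import Summits.HodgeConjecture.HodgeConjecture.Theorems.F3DualAbelianSchemeStubF3   -- ★ p797885 T4 CORE F3 `…F3DualAbelianScheme.stub_F3_holds` ([MumfordFogartyKirwan1994] Cor. 6.8 ∕ [MumfordAV1970] §13; F0P1c-p06 (g2) over (Z) (L) (K) (M))
import Summits.HodgeConjecture.HodgeConjecture.Theorems.F13PluckerProducerStubPL   -- ★ p795314 (ED. 2 ★ p796000) CORE PL `…F13PluckerProducer.stub_PL_of_cores_holds'` ([MumfordFogartyKirwan1994] Prop. 7.4 + §7.2 (*); F0-typ2 (g0))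
import Summits.HodgeConjecture.HodgeConjecture.Theorems.F11SmoothRoadAStubF11   -- ★ p806948 CORE F11 `…F11SmoothRoadA.stub_F11_holds` ([Lan2013PELCompactifications] Prop. 2.2.4.4 ∕ Thm. 2.2.4.14 deformation road A; B-p05 (g20), F0P1b-plan (g2) (R124)∕(R126)(c), over ★ MONO-G1 + ★ MONO-G2)
import Summits.HodgeConjecture.HodgeConjecture.Theorems.F0FloorSockets   -- ★ p796699 Theses-free FLOOR-0 socket module: `HFType` (abbrev of `lan2013_siegelFineModuliScheme`) = socket (F) = route item `F0HF` (R2)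
import HarnessLib

/-!
# FLOOR-0 socket (F) IS A THEOREM — `hF_holds : F0FloorSockets.HFType`, the Theorems-homed twin of the P1 head line `Cruxes/HDel/Lines/F0_SiegelModuli.lean` (ED. 1.8)

Cell `hodgecm-mathlib`, programme HC_CM FLOOR 0 (D-0183), programme P1 (moduli).  HONEST LABEL: HC_CM is proved only modulo the 7 printed
citations until rung 0 closes; THIS file discharges floor input I-1 ONLY — the printed existence statement
[Lan2013PELCompactifications, Thm. 1.4.1.11 + Cor. 7.2.3.9] ∕ [MumfordFogartyKirwan1994, Thm. 7.9 ∕ 7.10] typed as the tree's named fact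
★ `Literature.AlgebraicGeometry.ModuliOfAbelianVarieties.lan2013_siegelFineModuliScheme` — on Mathlib and the ★ Literature ∕ Theorems files alone
(axioms = the Lean trio).  Nothing here is about Hodge classes.

WHAT IT IS.  The P1 head line `Cruxes/HDel/Lines/F0_SiegelModuli.lean` (F0P1-plan (g0∕g2); registrar B-plan1) is SORRY-FREE at ED. 1.8 (its four
registered cores II ∕ F3 ∕ PL ∕ F11 are theorems BY NAME over ★ twins); crux workfiles under `Cruxes/…/Lines` are not built on the farm, so the
head's two-step proof is RE-HOMED here BY IMPORT over the same four ★ names (no letter is restated, no `Cruxes/…/Lines` import — EDITION-BOOK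
RULING 23:10:50Z 08-30), exactly as `Theorems/F3DualAbelianSchemeStubF3.lean` re-homed the F-3 head:

* `lan2013_siegelFineModuliScheme_of_cores` — (F) from the four cores: ★ F-12-of-cores ED. 3 `exists_threshold_siegelFineModuliScheme_of_cores''`
  ([MFK94] Thm. 7.9 «for `n` large»: F-9a frames, F-5 Hilbert scheme, R-C2 linearly rigidified covariant, F-8 slice-glued fine moduli scheme,
  F-9 quasi-projectivity — all ★) fed, in its binder order, CORE II = ★ `AbelianSchemeOver.exists_groupLawLocus_of_projective` ([MFK94] Prop. 6.16 ∕
  Thm. 6.14 step (II)), CORE F3 = ★ `F3DualAbelianScheme.stub_F3_holds` ([MFK94] Cor. 6.8: dual pairs Zariski-locally of projective abelian schemes,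
  Mumford's road `Â := A ⁄ K(L)`), CORE PL = ★ `F13PluckerProducer.stub_PL_of_cores_holds'` at (II, F3) ([MFK94] Prop. 7.4 + §7.2 (*): the Plücker
  letter of the linearly rigidified covariant), CORE F11 = ★ `F11SmoothRoadA.stub_F11_holds` ([Lan13] Prop. 2.2.4.4 ∕ Thm. 2.2.4.14: smoothness over
  `ℚ` by the deformation road); then ★ F-10 LEVEL DESCENT `lan2013_siegelFineModuliScheme_of_large_levels β h` (the remark after [MFK94] Thm. 7.9
  «true even if `n ≥ 3`», Lemma 7.11; [Lan13] Cor. 1.4.1.12).  Term = the P1 head `lan2013_siegelFineModuliScheme_holds` with the line's four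
  core theorems replaced by their ★ bodies.
* `hF_holds` — FLOOR-0 socket (F) BY NAME: the same term read at the Theses-free socket type ★
  `Summit.HodgeConjecture.HodgeConjecture.Theorems.F0FloorSockets.HFType` (`abbrev HFType := lan2013_siegelFineModuliScheme`; director g14 s386 (R1) ∕
  s416 (b)(i) ∕ s418 «socket hF»).  R2 (operator route edit 2026-08-31 02:00Z, `Theses/HCCMUnconditional.lean` rev 1, commit 7a24856f3f6c; director g14 s426)
  registered the support item `F0HF` = stmt-HodgeConjecture-27454 (`def F0HF : Prop := …F0FloorSockets.HFType`, l. 211); the 10-line closer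
  `theorem F0HF_holds : …Theses.HCCMUnconditional.F0HF := hF_holds` is filed `--workitem stmt-HodgeConjecture-27454` in a separate file AFTER «CONE BUILT»
  (this module stays Theses-free: none of its imports reaches `Theses.HCCMUnconditional`;
  in particular it does NOT import `Theorems.EquidimRelDimOfF`, and it does NOT conclude the crux decl `HDel` — the closer of item 24835 is the
  registry twin `Theorems/HCCMUnconditionalHDelOfF0.lean`, one closer per item, s418 FOLLOW-ON).

0 `def`, 0 `instance`, 0 `notation`, 0 `axiom`, 0 `sorry`; two theorems.  Namespace `Summit.HodgeConjecture.HodgeConjecture.Theorems.F0HFOfSiegelModuli`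
(file-named, as ★ `Theorems.F0FloorSockets`; no clash with the line namespace `…Cruxes.HypDel.F0SiegelModuli`).  Author of the bytes: F0P1-plan (g2)
(cutter of the P1 head line); filer: the prover named on the cell bus (s418: B-p01 (g17) by default).
-/

-- the mandated namespace has the single-problem summit's repeated segment (`HodgeConjecture.HodgeConjecture`)
set_option linter.dupNamespace false

noncomputable section

namespace Summit.HodgeConjecture.HodgeConjecture.Theorems.F0HFOfSiegelModuli

/-- **(F) from the four ★ cores — [MumfordFogartyKirwan1994, Thm. 7.9 with the remark following it ∕ Thm. 7.10; Lan2013PELCompactifications,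
Thm. 1.4.1.11 + Cor. 7.2.3.9]**: for `0 < g`, a polarisation type `δ` and `N ≥ 3` the Siegel moduli functor `𝓐_{g,δ,N}` is represented over `ℚ` by a
smooth quasi-projective fine moduli scheme with quasi-projective universal family.  Proof = the P1 head's two steps: ★ F-12-of-cores ED. 3
`exists_threshold_siegelFineModuliScheme_of_cores''` fed CORE II (★ F23), CORE F3 (★ T4), CORE PL (★ F-13 twin at (II, F3)), CORE F11 (★ F-11 twin),
then ★ F-10 level descent.
[cite: MumfordFogartyKirwan1994, Ch. 7 §3 Theorem 7.9 with the remark following it and Theorem 7.10 (p. 139)]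
[cite: Lan2013PELCompactifications, Thm. 1.4.1.11 (p. 91) and Cor. 7.2.3.9 (p. 518)] -/
theorem lan2013_siegelFineModuliScheme_of_cores :
    Literature.AlgebraicGeometry.ModuliOfAbelianVarieties.lan2013_siegelFineModuliScheme := by
  -- [MFK94] Thm. 7.9 «for `n` large»: the threshold `β` and the fine moduli carriers at every level `N ≥ β g δ`, from the four ★ cores
  obtain ⟨β, h⟩ :=
    Literature.AlgebraicGeometry.ModuliOfAbelianVarieties.exists_threshold_siegelFineModuliScheme_of_cores''
      Literature.AlgebraicGeometry.AbelianSchemes.AbelianSchemeOver.exists_groupLawLocus_of_projective          -- CORE II  (★ p796432 F23)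
      Summit.HodgeConjecture.CorCM.Cruxes.HypDel.F3DualAbelianScheme.stub_F3_holds                               -- CORE F3  (★ p797885 T4)
      (Summit.HodgeConjecture.CorCM.Cruxes.HypDel.F13PluckerProducer.stub_PL_of_cores_holds'                     -- CORE PL  (★ p796000 F-13 twin ED. 2)
        Literature.AlgebraicGeometry.AbelianSchemes.AbelianSchemeOver.exists_groupLawLocus_of_projective
        Summit.HodgeConjecture.CorCM.Cruxes.HypDel.F3DualAbelianScheme.stub_F3_holds)
      Summit.HodgeConjecture.CorCM.Cruxes.HypDel.F11SmoothRoadA.stub_F11_holds                                   -- CORE F11 (★ p806948 F-11 twin)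
  -- the remark after Thm. 7.9 «true even if `n ≥ 3`»: ★ F-10 level descent
  exact Literature.AlgebraicGeometry.ModuliOfAbelianVarieties.lan2013_siegelFineModuliScheme_of_large_levels β h

/-- **FLOOR-0 SOCKET (F) `hF_holds` — ★ `F0FloorSockets.HFType` BY NAME** (the binder `hF` of ★ `hc_cm_of_generic_floor_v7`, l. 69; route item `F0HF`
after R2): `abbrev HFType := lan2013_siegelFineModuliScheme`, so the term is `lan2013_siegelFineModuliScheme_of_cores` itself.  HC_CM is proved only
modulo the 7 printed citations until rung 0 closes. [cite: Lan2013PELCompactifications, Thm. 1.4.1.11 (p. 91)] -/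
theorem hF_holds : Summit.HodgeConjecture.HodgeConjecture.Theorems.F0FloorSockets.HFType :=
  lan2013_siegelFineModuliScheme_of_cores

end Summit.HodgeConjecture.HodgeConjecture.Theorems.F0HFOfSiegelModuli

end
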